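import Summits.AtomisticToContinuum.Crystallization.Theses.LaminarSixThreeThree
import Summits.AtomisticToContinuum.Crystallization.Theses.PoissonBesselStacking
import Literature.MathematicalPhysics.StatisticalMechanics.BarlowStackingEnergy

/-!
# Sketch — crux-ideate stmt-AtomisticToContinuum-14296 (`StackingFaultSparsity`), ideator 1, round 1

First lemmas of the two idea cards (`conditioned-bs-limit-exact-barlow`,
`shockley-slab-restacking`) and the shared coarsening input, typed over existing declarations.
Nothing here is a skeleton; `sorry` is not used.  Namespace per crux protocol.
-/

noncomputable section

open scoped BigOperators Topology
open Filter MeasureTheory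
open Literature.MathematicalPhysics.StatisticalMechanics

namespace Summit.AtomisticToContinuum.Crystallization.Cruxes.StackingFaultSparsity.IdeatorOne

local notation "E3" => EuclideanSpace ℝ (Fin 3)

/-! ## The matching predicates of the crux, abbreviated -/

/-- Two-way `(R, ε)`-match of the window of particle `i` of `y` with the point set `S` based at
`z ∈ S`, after the linear isometry `A` (verbatim the matching clause of `StackingFaultSparsity`). -/
def TwoWay (S : Set E3) (R ε : ℝ) {N : ℕ} (y : Fin N → E3) (i : Fin N) (z : E3)
    (A : E3 →ₗᵢ[ℝ] E3) : Prop :=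
  (∀ p ∈ S, dist p z ≤ R → ∃ j : Fin N, dist (y j) (y i + A (p - z)) ≤ ε) ∧
    (∀ j : Fin N, dist (y j) (y i) ≤ R → ∃ p ∈ S, dist (y j) (y i + A (p - z)) ≤ ε)

/-- `i` has an `(R, ε)`-window on SOME Barlow stacking (first conjunct of the crux's bad set). -/
def BarlowM (R ε : ℝ) {N : ℕ} (y : Fin N → E3) (i : Fin N) : Prop :=
  ∃ a h : ℝ, 1 / 2 < a ∧ a < 2 ∧ 1 / 2 < h ∧ h < 2 ∧ ∃ s : ℤ → ℤ, IsHaggSeq s ∧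
    ∃ z ∈ barlowStacking a h s, ∃ A : E3 →ₗᵢ[ℝ] E3, TwoWay (barlowStacking a h s) R ε y i z A

/-- `i` has an `(R, ε)`-window on SOME hcp stacking (negated second conjunct of the bad set). -/
def HcpM (R ε : ℝ) {N : ℕ} (y : Fin N → E3) (i : Fin N) : Prop :=
  ∃ a h : ℝ, 1 / 2 < a ∧ a < 2 ∧ 1 / 2 < h ∧ h < 2 ∧
    ∃ z ∈ hcpStacking a h, ∃ A : E3 →ₗᵢ[ℝ] E3, TwoWay (hcpStacking a h) R ε y i z A

/-- The crux, restated through the abbreviations (definitionally the route decl, see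
`crux_iff`). -/
def Crux : Prop :=
  ∀ R ε : ℝ, 0 < R → 0 < ε → ε < 1 / 4 → ∀ x : (N : ℕ) → (Fin N → E3),
    (∀ N, IsGroundState lennardJones (x N)) →
      Tendsto (fun N : ℕ => (Nat.card {i : Fin N // BarlowM R ε (x N) i ∧ ¬ HcpM R ε (x N) i} : ℝ) / N)
        atTop (𝓝 0)

/-- The shared item stmt-AtomisticToContinuum-14296 is the SAME term in both routes
(`SquareWellLayerCake.StackingFaultSparsity`, `LaminarSixThreeThree.StackingFaultSparsity`, verbatim
signature); this published copy imports the LaminarSixThreeThree file (the folder copy checks the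
`SquareWellLayerCake` decl by the same `Iff.rfl`). -/
theorem crux_iff :
    Crux ↔ Summit.AtomisticToContinuum.Crystallization.Theses.LaminarSixThreeThree.StackingFaultSparsity :=
  Iff.rfl

/-! ## Shared input of both lines: coarsening of FAULTED Barlow grains (the X-type content)

`FaultedGrainCoarsening` is sandwiched: it follows from the crux (`coarsening_of_crux`) and from
the sibling target X = `LaminarBarlowWindows` (`coarsening_of_laminarBarlowWindows`), both by
monotonicity of `Nat.card` of subtypes; it is the part of the crux that no stacking-selection
mechanism can supply (bounded faulted grains floating in a non-Barlow bulk, refuter note S1 on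
the item), isolated so that the selection levers below carry only the selection. -/
def FaultedGrainCoarsening : Prop :=
  ∀ R ε L ε' : ℝ, 0 < R → 0 < ε → ε < 1 / 4 → 0 < L → 0 < ε' → ε' < 1 / 4 →
    ∀ x : (N : ℕ) → (Fin N → E3), (∀ N, IsGroundState lennardJones (x N)) →
      Tendsto (fun N : ℕ =>
        (Nat.card {i : Fin N // (BarlowM R ε (x N) i ∧ ¬ HcpM R ε (x N) i) ∧ ¬ BarlowM L ε' (x N) i} : ℝ) / N)
        atTop (𝓝 0)

/-- Squeeze: a smaller subtype has smaller `Nat.card`, so its density tends to `0` too. -/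
theorem tendsto_density_mono {P Q : (N : ℕ) → Fin N → Prop} (hPQ : ∀ N i, P N i → Q N i)
    (hQ : Tendsto (fun N : ℕ => (Nat.card {i : Fin N // Q N i} : ℝ) / N) atTop (𝓝 0)) :
    Tendsto (fun N : ℕ => (Nat.card {i : Fin N // P N i} : ℝ) / N) atTop (𝓝 0) := by
  refine squeeze_zero (fun N => by positivity) (fun N => ?_) hQ
  refine div_le_div_of_nonneg_right ?_ (Nat.cast_nonneg N)
  have : Nat.card {i : Fin N // P N i} ≤ Nat.card {i : Fin N // Q N i} :=
    Nat.card_le_card_of_injective (fun i => ⟨i.1, hPQ N i.1 i.2⟩)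
      (fun a b hab => Subtype.ext (by simpa using congrArg Subtype.val hab))
  exact_mod_cast this

/-- The crux implies the coarsening of faulted grains (so the latter is not a costume of X). -/
theorem coarsening_of_crux (hC : Crux) : FaultedGrainCoarsening := by
  intro R ε L ε' hR hε hε4 _ _ _ x hx
  exact tendsto_density_mono (fun N i hi => hi.1) (hC R ε hR hε hε4 x hx)

/-- X = `LaminarBarlowWindows` (target of route LaminarSixThreeThree, derived inside `closes` of
SquareWellLayerCake from K1–K3) implies the coarsening of faulted grains: in the routes the input is free. -/
theorem coarsening_of_laminarBarlowWindows
    (hX : Summit.AtomisticToContinuum.Crystallization.Theses.LaminarSixThreeThree.LaminarBarlowWindows) :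
    FaultedGrainCoarsening := by
  intro R ε L ε' _ _ _ hL hε' hε'4 x hx
  exact tendsto_density_mono (fun N i hi => hi.2) (hX L ε' hL hε' hε'4 x hx)

/-! ## Card `conditioned-bs-limit-exact-barlow` — first lemma

Measure-level, SCALE-FREE stacking selection for laws carried by EXACT Barlow stackings: a
point-stationary probability law on rooted configurations that is a.s. a rigid image of some
`barlowStacking a h s` (`a, h ∈ [1/2, 2]`, any Hägg word) and whose expected root energy is at most
the periodic infimum `e*` is a.s. a rigid image of an hcp stacking with parameters in the
Poisson–Bessel box `B = [47/50, 1] × [39a/50, 17a/20]`.  (Hard core is automatic: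
`le_dist_barlowPos`, spacing `≥ min a h ≥ 1/2`.) -/
def ExactBarlowLawsAreHcp : Prop :=
  ∀ P : Measure (Measure E3), IsProbabilityMeasure P →
    (∀ᵐ μ ∂P, ∃ (a h : ℝ) (s : ℤ → ℤ) (g : E3 ≃ᵃⁱ[ℝ] E3),
      1 / 2 ≤ a ∧ a ≤ 2 ∧ 1 / 2 ≤ h ∧ h ≤ 2 ∧ IsHaggSeq s ∧
      (0 : E3) ∈ g '' barlowStacking a h s ∧
      μ = (Measure.count : Measure E3).restrict (g '' barlowStacking a h s)) →
    (∀ G : Measure E3 → E3 → ENNReal, Measurable (Function.uncurry G) →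
      ∫⁻ μ, ∫⁻ y, G μ y ∂μ ∂P = ∫⁻ μ, ∫⁻ y, G (Measure.map (fun z => z - y) μ) (-y) ∂μ ∂P) →
    (∫ μ, (∫ y, lennardJones ‖y‖ ∂μ) / 2 ∂P) ≤
      (⨅ Q : PeriodicConfiguration 3, Q.energyPerParticle lennardJones) →
    ∀ᵐ μ ∂P, ∃ (a h : ℝ) (g : E3 ≃ᵃⁱ[ℝ] E3),
      47 / 50 ≤ a ∧ a ≤ 1 ∧ 39 / 50 * a ≤ h ∧ h ≤ 17 / 20 * a ∧
      (0 : E3) ∈ g '' hcpStacking a h ∧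
      μ = (Measure.count : Measure E3).restrict (g '' hcpStacking a h)

/-- The coarse SCALE GAP that pins `(a, h)` into the box before any word comparison (certified
lattice sums; the word enters only through `- ∑ |J_k|`): off the box, the stacking-independent
part `e₀(a,h)` minus the total registry coupling already exceeds the hcp energy at a box point by
`1/1000` (measured infimum of the gap ≈ 5.0e-3, attained as `(a, h/a) → (0.96, 0.85⁺)`, i.e. at the
top edge of the box; total coupling there `∑|J_k| ≈ 4.4e-5`; folder numerics/layer_sums.py). -/
def BarlowScaleGap : Prop :=
  ∃ (a₀ h₀ : ℝ) (ha₀ : a₀ ≠ 0) (hh₀ : h₀ ≠ 0), 47 / 50 ≤ a₀ ∧ a₀ ≤ 1 ∧ 39 / 50 * a₀ ≤ h₀ ∧ h₀ ≤ 17 / 20 * a₀ ∧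
    ∀ a h : ℝ, 1 / 2 ≤ a → a ≤ 2 → 1 / 2 ≤ h → h ≤ 2 →
      ¬ (47 / 50 ≤ a ∧ a ≤ 1 ∧ 39 / 50 * a ≤ h ∧ h ≤ 17 / 20 * a) →
      (hcpPeriodicConfiguration ha₀ hh₀).energyPerParticle lennardJones + 1 / 1000 ≤
        barlowBaseEnergy lennardJones a h - ∑' k : ℕ, |barlowCoupling lennardJones a h (k + 2)|

/-! ## Card `shockley-slab-restacking` — first lemma

Deterministic, single-configuration DILUTENESS of cubic layers: in a Lennard-Jones ground state,
every particle whose `(L, ε')`-window is two-way matched to an exact Barlow stacking with box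
parameters sees at most `M₀` cubic layers (`s (m-1) = s m`, a non-alternation of the Hägg word)
among the layers within `L/2` of its own — `M₀` independent of `L`, `ε' = ε'(L)`. -/
def DiluteFaults : Prop :=
  ∃ (M₀ : ℕ) (L₀ : ℝ), ∀ L : ℝ, L₀ ≤ L → ∃ ε' : ℝ, 0 < ε' ∧
    ∀ (N : ℕ) (x : Fin N → E3), IsGroundState lennardJones x →
      ∀ (i : Fin N) (a h : ℝ) (s : ℤ → ℤ) (k i₀ j₀ : ℤ) (A : E3 →ₗᵢ[ℝ] E3),
        47 / 50 ≤ a → a ≤ 1 → 39 / 50 * a ≤ h → h ≤ 17 / 20 * a → IsHaggSeq s →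
        TwoWay (barlowStacking a h s) L ε' x i (barlowPos a h s k i₀ j₀) A →
        ((Finset.Icc (k - ⌊L / (2 * h)⌋) (k + ⌊L / (2 * h)⌋)).filter
            (fun m : ℤ => s (m - 1) = s m)).card ≤ M₀

/-- The energetics behind `DiluteFaults`, as the one inequality the surgery needs from the
lattice sums (a finite-disc, perturbed form is the prover's business): restacking gain per site and
per removed cubic layer is at least `|J₂|/2` on the box — literally `LjRegistryDomination` (item
stmt-AtomisticToContinuum-3063, shared with every line on this crux). -/
def RestackingGainOnBox : Prop :=
  Summit.AtomisticToContinuum.Crystallization.Theses.PoissonBesselStacking.LjRegistryDomination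

end Summit.AtomisticToContinuum.Crystallization.Cruxes.StackingFaultSparsity.IdeatorOne

end
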